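import Summits.RiemannHypothesis.RiemannHypothesis.Theorems.Splittings.LiRephasingScales
import HarnessLib
import Literature.NumberTheory.LFunctions.LittlewoodPsiOscillationRH

/-!
# LI B18 KERNEL Q5/6 — THE MOVING CUT `Y_n = √n · log n`: ANALYSIS LEMMAS AND `exists_scale_PL` (SketchG16B §9, ll.1136–1401) — PURE / RH-FREE

PRE-CUT (not filed).  Lane (xi-q) «LI B18 KERNEL» ×6 = Q1 `LiRephasingGainBudget` → Q2 `LiOneStepRephasing` → Q3 `LiRephasingSchedule` →
Q4 `LiRephasingScales` → Q5 `LiRephasingMovingCutPrelim` → Q6 `LiRephasingMovingCut` RESERVED by RULING #204 (rh-split lead g6,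
2026-08-27T18:03:10Z): GO = (xi-p) `LiRephasingKit` ACCEPTED (p553624, 18:01:43Z) + referee g8 BYTES and negctl replay on the six carved shas;
LOWEST priority; filing words `--supports stmt-RiemannHypothesis-19649 --as helper`, kind auto, parts land in chain order.  Cell rh-split,
seat rh-split-li-bridge (kernel author g16, cutter g17; brief sha16 f79c5f09d8bcb036), card `run/shared/lean/pub/rh-split/cards/SPLIT-li-bridge.md`
§23 / 23.8 (model barrier B18 «INCREMENT-LEVEL RE-PHASING ⟂ COUNTING-LAW BRIDGES»).  Kernel source `HOME/rh-split-li-bridge/SketchG16B.lean`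
sha16 cf2b65fdbda323e2 (1639 l, ns `RhSplit.LiBridgeG16`, farm rc 0 · 0 err · 0 warn · 0 sorry, std axioms; §§1–6 = `SketchG16.lean`
355f955084e6fc2c byte-identical prefix, referee REPLAY PASS 17:02Z / RULING #176; §§7–9 referee REPLAY PASS 17:28:47Z / RULING #186);
cut plan `CARVE-16.md` 677f9696f1bd3382; reconstruction note `HOME/rh-split-li-bridge/carve-16/README.md` (CUT ONLY — no regeneration).
THIS PART = scratch ll.1136–1401 (§9 up to and including `exists_scale_PL`; the `Schedule` trio ll.1403–1426 rides in Q3 `LiRephasingSchedule`,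
the rest of §9 is Q6)
↦ ll.53–318 here; decl text BYTE-VERBATIM (statements AND proofs, scratch section headers kept).  Deltas = namespace
`RhSplit.LiBridgeG16` ↦ `Summit.RiemannHypothesis.RiemannHypothesis.Theorems.Splittings.LiRephasingMovingCutPrelim`, imports (Q4 `…Splittings.LiRephasingScales` + HarnessLib),
this header, `set_option linter.dupNamespace false`, the `open` lines (the scratch's + `…Splittings.LiRephasingKit` + the earlier parts'
namespaces).  The six SketchG15B lemmas of scratch §1 (`exists_sin_eq_neg_one_of_phase_drop`, `four_sin_half_mul_sin`,
`sum_range_phase_telescope`, `abs_sum_range_phase_le`, `abs_sum_range_family_le`, `exists_le_on_block`) are CITED from the tree's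
`LiRephasingKit` (lane (xi-p)), never restated.

Content: §9 (first part) PURE analysis for the moving cut: (`two_log_le` = the tree's `LittlewoodRH.two_mul_log_le`, CITED — typer dedup repair xiq-e), `sqrt_mul_log_le`, `sqrt_mul_log_mono`, `large_N_facts`
(`N ≥ 3072⁴`), `count_term_le`, `drift_term_le`, `budget_arith'`, `next_floor_ge`, and **`exists_scale_PL`** (a scale above any floor
`T ≥ 260` with cut `Y = √N · log N`, next floor `√(2N) · log(2N)`, `J = 2548m + ⌈2C⌉₊ + 2`, all `Schedule` inequalities for the
PL-shaped floor).  Uses Q4's `count_le'`.  0 defs, 9 theorems.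

HONEST LABEL: SPLITTING SEARCH over kernel-typed RH-EQUIVALENCES; a splitting A ∧ B ⟹ RH is CONDITIONAL bookkeeping
unless A and B are both proved; nothing here bears on the truth of RH.  Every theorem below is PURE (trigonometry /
finite sums / calculus / parameter arithmetic) or RH-FREE (about the true zeta zeros, no hypothesis on their real parts);
none is a claim about RH, PL or K7ev; the whole chain is BARRIER-SIDE bookkeeping (B18), not a conjunct toward RH.
-/

set_option linter.dupNamespace false

namespace Summit.RiemannHypothesis.RiemannHypothesis.Theorems.Splittings.LiRephasingMovingCutPrelim

open Real Set Finset
open Literature.NumberTheory.LFunctions Literature.NumberTheory.LFunctions.SchoenfeldBound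
open Literature.NumberTheory.LFunctions.AlpogeFurman2026
open Literature.NumberTheory.LFunctions.SoundTest
open Summit.RiemannHypothesis.RiemannHypothesis.Theorems.LiTheory
open Summit.RiemannHypothesis.RiemannHypothesis.Theorems.Splittings
open Summit.RiemannHypothesis.RiemannHypothesis.Theorems.Splittings.LiIncrHighPart
open Summit.RiemannHypothesis.RiemannHypothesis.Theorems.Splittings.LiRephasingKit
open Summit.RiemannHypothesis.RiemannHypothesis.Theorems.Splittings.LiRephasingGainBudget
open Summit.RiemannHypothesis.RiemannHypothesis.Theorems.Splittings.LiOneStepRephasing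
open Summit.RiemannHypothesis.RiemannHypothesis.Theorems.Splittings.LiRephasingSchedule
open Summit.RiemannHypothesis.RiemannHypothesis.Theorems.Splittings.LiRephasingScales

/-! ## §9 The PÓLYA–LANDAU cut made literal — PURE / RH-FREE

§8 violates the floor at the FIXED cut `Y_k` (top of zone `k`'s averaging range) along the block `[N_k, 2N_k)`.  The
cell's `LowPhaseLaw K` (lane (xi-o)) uses the MOVING cut `Y_n = √n · log n`.  Here the scale is re-chosen with
`Y_k := √N_k · log N_k` (= `Y_{N_k}`), the next floor `T_{k+1} := √(2N_k) · log(2N_k)` (= `Y_{2N_k}`), and the drift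
`lowSumRe g n (Y_n) − lowSumRe g n (Y_{N_k})` for `N_k ≤ n < 2N_k` is paid from the budget through `lowSumRe_cut_le`
and the crude count `N(Y_{2N_k}) ≤ 3 (Y_{2N_k}+1) log(Y_{2N_k}+3)` (the zeros between the two cuts lie in NO zone, so the
re-phasing is the identity there).  Result: `theoremA_infty_PL` / `rephasing_kills_lowPhaseLaw` — the re-phased analogue
of `LowPhaseLaw K` fails for EVERY `K`. -/

/-- `√x · log x ≤ x` (`x ≥ 0`). PURE. -/
theorem sqrt_mul_log_le {x : ℝ} (hx : 0 ≤ x) : Real.sqrt x * Real.log x ≤ x := by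
  rcases hx.eq_or_lt with h | h
  · rw [← h]; simp
  have hs : 0 < Real.sqrt x := Real.sqrt_pos.2 h
  have h1 : Real.log x = 2 * Real.log (Real.sqrt x) := by rw [Real.log_sqrt hx]; ring
  rw [h1]
  calc Real.sqrt x * (2 * Real.log (Real.sqrt x)) ≤ Real.sqrt x * Real.sqrt x :=
        mul_le_mul_of_nonneg_left (Literature.NumberTheory.LFunctions.LittlewoodRH.two_mul_log_le hs) hs.le
    _ = x := Real.mul_self_sqrt hx

/-- `√x · log x` is monotone on `[1, ∞)`. PURE. -/
theorem sqrt_mul_log_mono {x y : ℝ} (hx : 1 ≤ x) (hxy : x ≤ y) :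
    Real.sqrt x * Real.log x ≤ Real.sqrt y * Real.log y :=
  mul_le_mul (Real.sqrt_le_sqrt hxy) (Real.log_le_log (by linarith) hxy) (Real.log_nonneg hx)
    (Real.sqrt_nonneg _)

/-- Basic facts at a large block start `N ≥ 3072⁴`: `3072² ≤ √N`, `31 ≤ log N`, `√N ≤ Y := √N log N ≤ N`. PURE. -/
theorem large_N_facts {N : ℝ} (hN : (3072 : ℝ) ^ 4 ≤ N) :
    3072 ^ 2 ≤ Real.sqrt N ∧ 31 ≤ Real.log N ∧ Real.sqrt N ≤ Real.sqrt N * Real.log N ∧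
      Real.sqrt N * Real.log N ≤ N := by
  have hN0 : 0 < N := lt_of_lt_of_le (by norm_num) hN
  have h1 : (3072 : ℝ) ^ 2 ≤ Real.sqrt N := by
    rw [Real.le_sqrt (by norm_num) hN0.le]; nlinarith
  have h2 : 31 ≤ Real.log N := by
    have h246 : (2 : ℝ) ^ 46 ≤ N := le_trans (by norm_num) hN
    have := Real.log_le_log (by norm_num) h246
    rw [Real.log_pow] at this
    push_cast at this
    linarith [Real.log_two_gt_d9]
  refine ⟨h1, h2, le_mul_of_one_le_right (Real.sqrt_nonneg _) (by linarith), sqrt_mul_log_le hN0.le⟩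

/-- **COUNT TERM.**  At `Y = √N log N`, `N ≥ 3072⁴`: `12 (Y+1) log(Y+3) ≤ N` (so `4·N(Y)/N ≤ 1`). PURE
(uses the tree's `LiLowZeroBudget.log_sq_le : log(x+3)² ≤ 32 √x`). -/
theorem count_term_le {N : ℝ} (hN : (3072 : ℝ) ^ 4 ≤ N) :
    12 * (Real.sqrt N * Real.log N + 1) * Real.log (Real.sqrt N * Real.log N + 3) ≤ N := by
  obtain ⟨hu, hlogN, hYu, hYN⟩ := large_N_facts hN
  have hN0 : 0 < N := lt_of_lt_of_le (by norm_num) hN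
  set u := Real.sqrt N with hudef
  set Y := u * Real.log N with hYdef
  have hu0 : 0 ≤ u := Real.sqrt_nonneg _
  have huu : u * u = N := Real.mul_self_sqrt hN0.le
  have hu1 : 1 ≤ u := le_trans (by norm_num) hu
  have hY1 : 1 ≤ Y := le_trans hu1 hYu
  -- `N + 3 ≤ (u+3)²`, hence `log N ≤ 2 log(u+3)` and `log(Y+3) ≤ 2 log(u+3)`
  have hsq : N + 3 ≤ (u + 3) ^ 2 := by nlinarith
  have hl0 : 0 ≤ Real.log (u + 3) := Real.log_nonneg (by linarith)
  have hlogN2 : Real.log N ≤ 2 * Real.log (u + 3) := by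
    have := Real.log_le_log hN0 (by linarith : N ≤ (u + 3) ^ 2)
    rwa [Real.log_pow, Nat.cast_ofNat] at this
  have hlogY3 : Real.log (Y + 3) ≤ 2 * Real.log (u + 3) := by
    have := Real.log_le_log (by linarith) (by linarith : Y + 3 ≤ (u + 3) ^ 2)
    rwa [Real.log_pow, Nat.cast_ofNat] at this
  have hlogY0 : 0 ≤ Real.log (Y + 3) := Real.log_nonneg (by linarith)
  have hsq32 : Real.log (u + 3) ^ 2 ≤ 32 * Real.sqrt u := LiLowZeroBudget.log_sq_le hu1
  -- `√u ≥ 3072`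
  have hsu : 3072 ≤ Real.sqrt u := by
    rw [Real.le_sqrt (by norm_num) hu0]; exact hu
  have hsu0 : 0 ≤ Real.sqrt u := Real.sqrt_nonneg _
  have hsuu : Real.sqrt u * Real.sqrt u = u := Real.mul_self_sqrt hu0
  -- the chain
  have hA : 12 * (Y + 1) * Real.log (Y + 3) ≤ 24 * Y * (2 * Real.log (u + 3)) :=
    mul_le_mul (by linarith) hlogY3 hlogY0 (by linarith)
  have hB : 24 * Y * (2 * Real.log (u + 3)) = 48 * u * (Real.log N * Real.log (u + 3)) := by
    rw [hYdef]; ring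
  have hC : Real.log N * Real.log (u + 3) ≤ 2 * Real.log (u + 3) ^ 2 := by nlinarith
  have hD : 48 * u * (Real.log N * Real.log (u + 3)) ≤ 48 * u * (2 * (32 * Real.sqrt u)) := by
    apply mul_le_mul_of_nonneg_left _ (by positivity)
    linarith
  have hE : 3072 * Real.sqrt u ≤ u := by nlinarith
  have hF : 48 * u * (2 * (32 * Real.sqrt u)) = 3072 * Real.sqrt u * u := by ring
  calc 12 * (Y + 1) * Real.log (Y + 3) ≤ 3072 * Real.sqrt u * u := by linarith
    _ ≤ u * u := mul_le_mul_of_nonneg_right hE hu0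
    _ = N := huu

/-- **DRIFT TERM.**  With `Y = √N log N`, `Y₂ = √(2N) log(2N)`, `N ≥ 3072⁴`:
`(2/Y) · 3 (Y₂+1) log(Y₂+3) ≤ 48 + 24 log N`. PURE. -/
theorem drift_term_le {N : ℝ} (hN : (3072 : ℝ) ^ 4 ≤ N) :
    2 / (Real.sqrt N * Real.log N) *
        (3 * (Real.sqrt (2 * N) * Real.log (2 * N) + 1) * Real.log (Real.sqrt (2 * N) * Real.log (2 * N) + 3)) ≤
      48 + 24 * Real.log N := by
  obtain ⟨hu, hlogN, hYu, hYN⟩ := large_N_facts hN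
  have hN0 : 0 < N := lt_of_lt_of_le (by norm_num) hN
  set u := Real.sqrt N with hudef
  set Y := u * Real.log N with hYdef
  set Y₂ := Real.sqrt (2 * N) * Real.log (2 * N) with hY₂def
  have hu0 : 0 ≤ u := Real.sqrt_nonneg _
  have hu1 : 1 ≤ u := le_trans (by norm_num) hu
  have hY1 : 1 ≤ Y := le_trans hu1 hYu
  have hY0 : 0 < Y := by linarith
  -- `√(2N) ≤ (3/2) √N`, `log 2N ≤ 2 log N`, so `Y₂ ≤ 3Y`
  have hs2 : Real.sqrt (2 * N) ≤ 3 / 2 * u := by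
    rw [Real.sqrt_le_left (by positivity)]
    nlinarith [Real.sq_sqrt hN0.le]
  have hs20 : 0 ≤ Real.sqrt (2 * N) := Real.sqrt_nonneg _
  have hlog2N : Real.log (2 * N) = Real.log 2 + Real.log N := Real.log_mul two_ne_zero hN0.ne'
  have hl2 : Real.log (2 * N) ≤ 2 * Real.log N := by rw [hlog2N]; linarith [Real.log_two_lt_d9]
  have hl20 : 0 ≤ Real.log (2 * N) := by rw [hlog2N]; linarith [Real.log_two_gt_d9]
  have hY₂ : Y₂ ≤ 3 * Y := by
    calc Y₂ = Real.sqrt (2 * N) * Real.log (2 * N) := rfl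
      _ ≤ 3 / 2 * u * (2 * Real.log N) := mul_le_mul hs2 hl2 hl20 (by positivity)
      _ = 3 * Y := by rw [hYdef]; ring
  have hY₂0 : 0 ≤ Y₂ := mul_nonneg hs20 hl20
  -- `log(Y₂+3) ≤ log(4N) ≤ 2 + log N`
  have hlogY₂ : Real.log (Y₂ + 3) ≤ 2 + Real.log N := by
    have h4 : Y₂ + 3 ≤ 4 * N := by linarith
    calc Real.log (Y₂ + 3) ≤ Real.log (4 * N) := Real.log_le_log (by linarith) h4
      _ = Real.log 4 + Real.log N := Real.log_mul (by norm_num) hN0.ne'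
      _ ≤ 2 + Real.log N := by
          have : Real.log 4 = 2 * Real.log 2 := by
            rw [show (4 : ℝ) = 2 ^ 2 by norm_num, Real.log_pow]; ring
          linarith [Real.log_two_lt_d9]
  have hlogY₂0 : 0 ≤ Real.log (Y₂ + 3) := Real.log_nonneg (by linarith)
  have hnum : 3 * (Y₂ + 1) * Real.log (Y₂ + 3) ≤ 12 * Y * (2 + Real.log N) :=
    mul_le_mul (by linarith) hlogY₂ hlogY₂0 (by linarith)
  calc 2 / Y * (3 * (Y₂ + 1) * Real.log (Y₂ + 3)) ≤ 2 / Y * (12 * Y * (2 + Real.log N)) :=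
        mul_le_mul_of_nonneg_left hnum (by positivity)
    _ = 48 + 24 * Real.log N := by field_simp; ring

/-- The quadratic budget beats the linear cost — constants for the moving cut. PURE. -/
theorem budget_arith' {m : ℕ} (hm : 0 < m) {L K C : ℝ} (hC0 : 0 ≤ C) (hC1 : 13 * m * (98 * L - K + 50) ≤ C)
    {J : ℕ} (hJ : (2548 * m + 2 * C + 2 : ℝ) ≤ J) :
    13 * m * (98 * (J * Real.log 2 + L) - K + 50) ≤ Real.log 2 * (J * (J - 1) / 2) := by
  have ha : 0.6931471803 < Real.log 2 := Real.log_two_gt_d9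
  have ha0 : 0 ≤ Real.log 2 := by linarith
  have hm0 : (0 : ℝ) ≤ m := Nat.cast_nonneg m
  have hJ2 : (2 : ℝ) ≤ J := by nlinarith
  have hJ0 : (0 : ℝ) ≤ J := by linarith
  have h1 : (J : ℝ) * (2548 * m + 2 * C + 2) ≤ (J : ℝ) * J := mul_le_mul_of_nonneg_left hJ hJ0
  have h4 : Real.log 2 * ((J : ℝ) * (2548 * m + 2 * C + 2)) ≤ Real.log 2 * ((J : ℝ) * J) :=
    mul_le_mul_of_nonneg_left h1 ha0
  have h2 : 1 ≤ Real.log 2 * J := by nlinarith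
  have h3 : C ≤ (Real.log 2 * J) * C := by nlinarith
  have h5 : 0 ≤ Real.log 2 * m * J := by positivity
  have h6 : 0 ≤ Real.log 2 * J := by positivity
  nlinarith

/-- The next zone floor is admissible: `260 ≤ √(2N) log(2N)` for `N ≥ 3072⁴`. PURE. -/
theorem next_floor_ge {N : ℝ} (hN : (3072 : ℝ) ^ 4 ≤ N) : 260 ≤ Real.sqrt (2 * N) * Real.log (2 * N) := by
  obtain ⟨hu, hlogN, -, -⟩ := large_N_facts hN
  have hN0 : 0 < N := lt_of_lt_of_le (by norm_num) hN
  have h1 : Real.sqrt N ≤ Real.sqrt (2 * N) := Real.sqrt_le_sqrt (by linarith)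
  have h2 : Real.log N ≤ Real.log (2 * N) := Real.log_le_log hN0 (by linarith)
  have := mul_le_mul (hu.trans h1) (hlogN.trans h2) (by norm_num) (Real.sqrt_nonneg _)
  linarith

/-- **EXISTENCE OF A SCALE, MOVING CUT.**  Above any floor `T ≥ 260`, for any sparsity `m ≥ 1` and floor constant `K`:
`J ≥ 2`, `N ≥ 3072⁴` with reach, decorrelation, `2^J T ≤ Y_N := √N log N`, and the budget inequality of
`floor_violation` at cut `Y_N` with `A = ½ log 2N − K + 1 + (drift allowance up to Y_{2N})`. PURE + tree count bound.
RH-FREE. -/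
theorem exists_scale_PL {T : ℝ} (hT : 260 ≤ T) {m : ℕ} (hm : 0 < m) (K : ℝ) :
    ∃ J N : ℕ, 2 ≤ J ∧ (3072 : ℝ) ^ 4 ≤ N ∧ 16 * π * (2 ^ J * T) ≤ (N : ℝ) ∧
      32 * (2 ^ J * T) ^ 2 * Real.log (2 ^ J * T) ≤ (N : ℝ) ∧
      2 ^ J * T ≤ Real.sqrt N * Real.log N ∧
      13 * m * ((Real.log (2 * N) / 2 - K + 1 + 2 / (Real.sqrt N * Real.log N) *
          (3 * (Real.sqrt (2 * N) * Real.log (2 * N) + 1) *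
            Real.log (Real.sqrt (2 * N) * Real.log (2 * N) + 3))) +
        4 * (∑ ρ ∈ zerosBetween 0 (Real.sqrt N * Real.log N), mult ρ) / N) ≤
        J * Real.log (T / (2 * π)) + Real.log 2 * (J * (J - 1) / 2) := by
  set C : ℝ := max (13 * m * (98 * Real.log T - K + 50)) 0 with hC
  have hC0 : 0 ≤ C := le_max_right _ _
  have hC1 : 13 * m * (98 * Real.log T - K + 50) ≤ C := le_max_left _ _
  set J : ℕ := 2548 * m + ⌈2 * C⌉₊ + 2 with hJdef
  have hJreal : (2548 * m + 2 * C + 2 : ℝ) ≤ J := by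
    have := Nat.le_ceil (2 * C)
    rw [hJdef]; push_cast; linarith
  have hJ5 : 5 ≤ J := by rw [hJdef]; omega
  have hT0 : 0 < T := by linarith
  set Z : ℝ := 2 ^ J * T with hZdef
  have h2J : (32 : ℝ) ≤ 2 ^ J := by
    calc (32 : ℝ) = 2 ^ 5 := by norm_num
      _ ≤ 2 ^ J := pow_le_pow_right₀ (by norm_num) hJ5
  have hZ : 8320 ≤ Z := by
    have := mul_le_mul h2J hT (by norm_num) (by positivity)
    rw [hZdef]; linarith
  have hZ260 : 260 ≤ Z := by linarith
  have hZ0 : 0 < Z := by linarith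
  -- the block start: `N = ⌈X⌉`, `X = 32 Z² log Z + 16πZ + 12 (Z+1) log(Z+3) + 3072⁴` (no ℕ literals: `whnf`-safe)
  have hlZ0 : 0 ≤ Real.log Z := Real.log_nonneg (by linarith)
  have hlZ3 : 0 ≤ Real.log (Z + 3) := Real.log_nonneg (by linarith)
  have hX0 : 0 ≤ 32 * Z ^ 2 * Real.log Z + 16 * π * Z + 12 * (Z + 1) * Real.log (Z + 3) + 3072 ^ 4 := by
    positivity
  obtain ⟨N, hNlo, hNhi⟩ : ∃ N : ℕ,
      32 * Z ^ 2 * Real.log Z + 16 * π * Z + 12 * (Z + 1) * Real.log (Z + 3) + 3072 ^ 4 ≤ N ∧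
      (N : ℝ) < 32 * Z ^ 2 * Real.log Z + 16 * π * Z + 12 * (Z + 1) * Real.log (Z + 3) + 3072 ^ 4 + 1 :=
    ⟨_, Nat.le_ceil _, Nat.ceil_lt_add_one hX0⟩
  have t1 : 0 ≤ 32 * Z ^ 2 * Real.log Z := by positivity
  have t2 : 0 ≤ 16 * π * Z := by positivity
  have t3 : 0 ≤ 12 * (Z + 1) * Real.log (Z + 3) := by positivity
  have hNbig : (3072 : ℝ) ^ 4 ≤ N := by linarith
  have hreach : 16 * π * Z ≤ (N : ℝ) := by linarith
  have hdec : 32 * Z ^ 2 * Real.log Z ≤ (N : ℝ) := by linarith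
  -- crude upper bound `N ≤ 32 Z³ + 3072⁴`
  have hNle : (N : ℝ) ≤ 32 * Z ^ 3 + 3072 ^ 4 := by
    have hlogZ' : Real.log Z ≤ Z - 1 := Real.log_le_sub_one_of_pos hZ0
    have hlog3 : Real.log (Z + 3) ≤ Z + 2 := by
      linarith [Real.log_le_sub_one_of_pos (show 0 < Z + 3 by linarith)]
    have p1 : 32 * Z ^ 2 * Real.log Z ≤ 32 * Z ^ 3 - 32 * Z ^ 2 := by nlinarith [sq_nonneg Z]
    have p2 : 16 * π * Z ≤ 64 * Z := by nlinarith [Real.pi_lt_four]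
    have p3 : 12 * (Z + 1) * Real.log (Z + 3) ≤ 12 * Z ^ 2 + 36 * Z + 24 := by nlinarith
    have p4 : 260 * Z ≤ Z ^ 2 := by nlinarith
    linarith
  have hN0 : (0 : ℝ) < N := lt_of_lt_of_le (by norm_num) hNbig
  obtain ⟨hu, hlogN, hYu, hYN⟩ := large_N_facts hNbig
  -- `Z ≤ √N ≤ Y_N`
  have hlogZ : 1 ≤ Real.log Z :=
    ((Real.lt_log_iff_exp_lt hZ0).2 (by linarith [Real.exp_one_lt_d9])).le
  have hZsq : Z ^ 2 ≤ N :=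
    calc Z ^ 2 = Z ^ 2 * 1 := by ring
      _ ≤ Z ^ 2 * (32 * Real.log Z) := mul_le_mul_of_nonneg_left (by linarith) (sq_nonneg Z)
      _ = 32 * Z ^ 2 * Real.log Z := by ring
      _ ≤ N := hdec
  have hZu : Z ≤ Real.sqrt N := by rw [Real.le_sqrt hZ0.le hN0.le]; exact hZsq
  have htop : Z ≤ Real.sqrt N * Real.log N := hZu.trans hYu
  refine ⟨J, N, by rw [hJdef]; omega, hNbig, hreach, hdec, htop, ?_⟩
  -- `log 2N ≤ 4 log Z = 4 (J log 2 + log T)`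
  have hlog2N : Real.log (2 * N) ≤ 4 * Real.log Z := by
    have hZ3 : (8320 : ℝ) ^ 3 ≤ Z ^ 3 := pow_le_pow_left₀ (by norm_num) hZ 3
    have hZ4 : 8320 * Z ^ 3 ≤ Z ^ 4 :=
      calc 8320 * Z ^ 3 ≤ Z * Z ^ 3 := mul_le_mul_of_nonneg_right hZ (pow_pos hZ0 3).le
        _ = Z ^ 4 := by ring
    have hY4 : 2 * (N : ℝ) ≤ Z ^ 4 := by linarith [hNle, hZ3, hZ4]
    calc Real.log (2 * N) ≤ Real.log (Z ^ 4) := Real.log_le_log (by positivity) hY4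
      _ = 4 * Real.log Z := by rw [Real.log_pow]; norm_num
  have hlogZe : Real.log Z = J * Real.log 2 + Real.log T := by
    rw [hZdef, Real.log_mul (by positivity) hT0.ne', Real.log_pow]
  have hlogT : 0 ≤ Real.log (T / (2 * π)) := by
    apply Real.log_nonneg
    rw [le_div_iff₀ (by positivity)]
    linarith [Real.pi_lt_four]
  -- count and drift terms
  have hY0' : (0 : ℝ) ≤ Real.sqrt N * Real.log N := le_trans (by norm_num) (hu.trans hYu)
  have hM := count_le' hY0'
  have hfrac : 4 * (∑ ρ ∈ zerosBetween 0 (Real.sqrt N * Real.log N), mult ρ) / N ≤ 1 := by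
    rw [div_le_one hN0]; linarith [count_term_le hNbig]
  have hdrift := drift_term_le hNbig
  have hm0 : (0 : ℝ) ≤ 13 * m := by positivity
  have hlogN' : Real.log N ≤ Real.log (2 * N) := Real.log_le_log hN0 (by linarith)
  have hstep : 13 * m * ((Real.log (2 * N) / 2 - K + 1 + 2 / (Real.sqrt N * Real.log N) *
          (3 * (Real.sqrt (2 * N) * Real.log (2 * N) + 1) *
            Real.log (Real.sqrt (2 * N) * Real.log (2 * N) + 3))) +
        4 * (∑ ρ ∈ zerosBetween 0 (Real.sqrt N * Real.log N), mult ρ) / N) ≤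
      13 * m * (98 * (J * Real.log 2 + Real.log T) - K + 50) := by
    apply mul_le_mul_of_nonneg_left _ hm0
    rw [hlogZe] at hlog2N
    linarith
  have hba := budget_arith' hm hC0 hC1 hJreal (L := Real.log T) (K := K)
  have hJ0 : (0 : ℝ) ≤ J := Nat.cast_nonneg J
  have hJT : 0 ≤ (J : ℝ) * Real.log (T / (2 * π)) := mul_nonneg hJ0 hlogT
  linarith

end Summit.RiemannHypothesis.RiemannHypothesis.Theorems.Splittings.LiRephasingMovingCutPrelim
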